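import Summits.Ventures.PercRepro.S1CellSub
import Summits.Ventures.PercRepro.S1CellCaps
import Summits.Ventures.PercRepro.S1TriangleSevenA

/-!
# PercRepro — the cells `(11, 7)`, `(11, 8)`, `(10, 11)` modulo a four-circuit cap (p2, gen 17; with p1's
averaging bounds INBOX 8541 / 8560 they close modulo `Q*(3) = 5`, `Q*(4) = 8`, `Q*(5) = 11`)

The sub-case cell inequality of `S1CellSub` (`d = 7, 8`) with the caps `s₃ ≤ P` and `s₄ ≤ S` (`cellOK13`), and the
three cores with the triangle half supplied by LEMMA Q and its sharpening (`s₃ ≤ 12` at corank `7`, `≤ 15` at `8`,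
`cq 11 = 30`) and the four-circuit half as a HYPOTHESIS `hS`: `(11, 7)` needs `s₄ ≤ 73` (twin `0.9769`), `(11, 8)`
needs `s₄ ≤ 105` (`0.9347`),
`(10, 11)` needs `s₄ ≤ 266` (`0.9363`; the plain `cellOK10` form). p1's `S1CoreCapAvg` supplies exactly these
(`ncard_fourCircuits_le_seventy_three / _one_hundred_five`, `avgBound 5 = 266`) modulo the three `FourCapSpec`
instances — the glue is `S1CellProps`.

* `cellOK13`, `cellOK13_spec`-free `rls_of_cellOK13` — the capped sub-case cell and its bridge to `RLS`;
* `cell_eleven_seven_caps`, `cell_eleven_eight_caps`, `cell_ten_eleven_caps` — the three kernel cells;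
* **`c025_core_eleven_seven_of_cap`**, **`c025_core_eleven_eight_of_cap`**, **`c025_core_ten_eleven_of_cap`**.
Axioms: standard.
-/

open scoped Matroid

namespace PercRepro

namespace S1

open Set

variable {α : Type}

/-- **The sub-case cell inequality with the caps `s₃ ≤ P`, `s₄ ≤ S`** (`d = 7, 8`): `cellOK9` with `s₃ ↦ min(s₃, P)`,
`s₄ ↦ min(s₄, S)`. -/
def cellOK13 (p d P S : ℕ) : Bool :=
  let n := p + d
  let m := min (5 * d) n
  let s3 := min (min (d * (d + 1) / 2) ((d * d + 6 - 3 * d) / 2)) P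
  let s4 := min (min (min (CoreRegimes.chooseF (d + 3) 4) (d * (d + 1) * (d + 2) / 3)) (fourCircuitBound d)) S
  let s5 := CoreRegimes.chooseF (d + 4) 5
  let piAll := s3 * CoreRegimes.chooseF (n - 3) 2 + s4 * (n - 4) + s5
  let piS0 := s3 * CoreRegimes.chooseF (m - 3) 2 + s4 * (m - 4) + s5
  let sigs := ∑ j ∈ Finset.range (d - 5 + 1), Nat.choose 2 j
  let sig := ∑ j ∈ Finset.range (d - 5 + 1), Nat.choose 5 j
  let Upf := if d = 7 then
      max (UformF p 7 (RB9 7) 0 12 s3 s4 s5) (UformF p 7 (RM 7) (7560 * betaK 10 7) (min 35 n) s3 s4 s5)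
    else
      max (max (UformF p 8 (RB9 8) (7560 * betaK 10 8) 13 s3 s4 s5)
          (UformF p 8 (RM 8) (7560 * betaK 10 8) (min 40 n) s3 s4 s5))
        (UformF p 8 (RB9 8) 0 (min 40 n) s3 s4 s5)
  let U := min Upf (7560 * (CoreRegimes.chooseF n 4 + sigs * piAll + (sig - sigs) * piS0))
  let R3 := 10584 * (s3 * (n - 3) + s4)
  let R4 := RSK 10 * piAll + (RBK 10 - RSK 10) * piS0
  let Ysum := 7560 * ∑ j ∈ Finset.Ico 5 p, CoreRegimes.chooseF n j
  let phiNum := 2 ^ (p + 4) - 2 * ∑ u ∈ Finset.range 5, CoreRegimes.chooseF (p + 4) u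
  let phiDen := CoreRegimes.chooseF (p + 4) 4
  decide ((d = 7 ∨ d = 8) ∧ R3 + R4 ≤ Ysum ∧ phiNum * U + phiDen * (R3 + R4) ≤ phiDen * Ysum)

/-- The cell `(11, 7)` with `s₃ ≤ 12` (nullity `7`, S1TriangleSeven) and `s₄ ≤ 73`, by kernel evaluation. -/
theorem cell_eleven_seven_caps : cellOK13 11 7 12 73 = true := by decide +kernel

/-- The cell `(11, 8)` with `s₃ ≤ 15` (nullity `8`, S1TriangleSeven) and `s₄ ≤ 105`, by kernel evaluation. -/
theorem cell_eleven_eight_caps : cellOK13 11 8 15 105 = true := by decide +kernel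

/-- The cell `(10, 11)` with `s₃ ≤ 30` (LEMMA Q) and `s₄ ≤ 266`, by kernel evaluation. -/
theorem cell_ten_eleven_caps : cellOK10 10 11 30 266 = true := by decide +kernel

/-- **FROM THE CAPPED SUB-CASE CELL TO `RLS`** (`d = 7` or `8`): on the `e`-free core with `s₃ ≤ P` and `s₄ ≤ S`,
a kernel-evaluated `cellOK13 p d P S = true` gives `ThmN.RLS M p 4`. -/
theorem rls_of_cellOK13 (M : Matroid α) [M.Finite] (p d P S : ℕ) (hR : M.eRank = (p : ℕ∞))
    (hn : M.E.ncard = p + d)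
    (hfree : ∀ e ∈ M.E, ∃ A ⊆ M.E \ {e}, e ∉ M.closure A ∧ e ∉ M.closure ((M.E \ {e}) \ A))
    (hP : {C : Set α | M.IsCircuit C ∧ C.ncard = 3}.ncard ≤ P) (hS : {C : Set α | M.IsCircuit C ∧ C.ncard = 4}.ncard ≤ S)
    (hp : 5 ≤ p) (hok : cellOK13 p d P S = true) : ThmN.RLS M p 4 := by
  classical
  -- the core facts
  have hL : ∀ e ∈ M.E, ¬ M.IsLoop e := ThmN.not_isLoop_of_free M hfree
  have hs : ∀ e ∈ M.E, ∀ f ∈ M.E, e ≠ f → M.eRk {e, f} = 2 := by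
    intro e he f hf hef
    have h2 : (2 : ℕ∞) ≤ M.eRk {e, f} :=
      ThmN.two_le_eRk_of_two_le_ncard_of_free M hfree (pair_subset he hf) (by rw [ncard_pair hef])
    have h3 : M.eRk {e, f} ≤ 2 := by
      have := M.eRk_le_encard {e, f}
      rwa [encard_pair hef] at this
    exact le_antisymm h3 h2
  have hcirc : ∀ C, M.IsCircuit C → 3 ≤ C.encard := ThmN.three_le_encard_of_circuit M hL hs
  have hline : ∀ L ⊆ M.E, M.eRk L ≤ 2 → L.ncard ≤ 3 := by
    intro L hL' hr
    have := ThmN.ncard_add_one_le_two_pow_of_eRk_le M hL hfree 2 L hL' hr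
    omega
  have hplane : ∀ P ⊆ M.E, M.eRk P ≤ 3 → P.ncard ≤ 6 := fun P hP hr =>
    ThmN.ncard_le_six_of_eRk_le_three_of_free M hfree hP hr
  have hten : ∀ X ⊆ M.E, M.eRk X ≤ 4 → X.ncard ≤ 10 := fun X hX hr =>
    ThmN.ncard_le_ten_of_eRk_le_four_of_free M hfree hX hr
  have hd : M.E.encard = M.eRank + d := by
    rw [hR, ← M.ground_finite.cast_ncard_eq, hn]
    push_cast
    ring
  -- the spec of the cell
  have hspec : (d = 7 ∨ d = 8) ∧
      10584 * (min (min (d * (d + 1) / 2) ((d * d + 6 - 3 * d) / 2)) P * (p + d - 3) +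
        min (min (min ((d + 3).choose 4) (d * (d + 1) * (d + 2) / 3)) (fourCircuitBound d)) S) +
      (RSK 10 * (min (min (d * (d + 1) / 2) ((d * d + 6 - 3 * d) / 2)) P * (p + d - 3).choose 2 +
          min (min (min ((d + 3).choose 4) (d * (d + 1) * (d + 2) / 3)) (fourCircuitBound d)) S * (p + d - 4) + (d + 4).choose 5) +
        (RBK 10 - RSK 10) * (min (min (d * (d + 1) / 2) ((d * d + 6 - 3 * d) / 2)) P * (min (5 * d) (p + d) - 3).choose 2 +
          min (min (min ((d + 3).choose 4) (d * (d + 1) * (d + 2) / 3)) (fourCircuitBound d)) S * (min (5 * d) (p + d) - 4) + (d + 4).choose 5)) ≤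
      7560 * ∑ j ∈ Finset.Ico 5 p, (p + d).choose j ∧
    (2 ^ (p + 4) - 2 * ∑ u ∈ Finset.range 5, (p + 4).choose u) *
        min (if d = 7 then
            max (Uform p 7 (RB9 7) 0 12 (min (min (d * (d + 1) / 2) ((d * d + 6 - 3 * d) / 2)) P)
                (min (min (min ((d + 3).choose 4) (d * (d + 1) * (d + 2) / 3)) (fourCircuitBound d)) S) ((d + 4).choose 5))
              (Uform p 7 (RM 7) (7560 * betaK 10 7) (min 35 (p + d)) (min (min (d * (d + 1) / 2) ((d * d + 6 - 3 * d) / 2)) P)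
                (min (min (min ((d + 3).choose 4) (d * (d + 1) * (d + 2) / 3)) (fourCircuitBound d)) S) ((d + 4).choose 5))
          else
            max (max (Uform p 8 (RB9 8) (7560 * betaK 10 8) 13 (min (min (d * (d + 1) / 2) ((d * d + 6 - 3 * d) / 2)) P)
                (min (min (min ((d + 3).choose 4) (d * (d + 1) * (d + 2) / 3)) (fourCircuitBound d)) S) ((d + 4).choose 5))
              (Uform p 8 (RM 8) (7560 * betaK 10 8) (min 40 (p + d)) (min (min (d * (d + 1) / 2) ((d * d + 6 - 3 * d) / 2)) P)
                (min (min (min ((d + 3).choose 4) (d * (d + 1) * (d + 2) / 3)) (fourCircuitBound d)) S) ((d + 4).choose 5)))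
            (Uform p 8 (RB9 8) 0 (min 40 (p + d)) (min (min (d * (d + 1) / 2) ((d * d + 6 - 3 * d) / 2)) P)
                (min (min (min ((d + 3).choose 4) (d * (d + 1) * (d + 2) / 3)) (fourCircuitBound d)) S) ((d + 4).choose 5)))
          (7560 * ((p + d).choose 4 +
            (∑ j ∈ Finset.range (d - 5 + 1), Nat.choose 2 j) *
              (min (min (d * (d + 1) / 2) ((d * d + 6 - 3 * d) / 2)) P * (p + d - 3).choose 2 +
                min (min (min ((d + 3).choose 4) (d * (d + 1) * (d + 2) / 3)) (fourCircuitBound d)) S * (p + d - 4) + (d + 4).choose 5) +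
            ((∑ j ∈ Finset.range (d - 5 + 1), Nat.choose 5 j) - (∑ j ∈ Finset.range (d - 5 + 1), Nat.choose 2 j)) *
              (min (min (d * (d + 1) / 2) ((d * d + 6 - 3 * d) / 2)) P * (min (5 * d) (p + d) - 3).choose 2 +
                min (min (min ((d + 3).choose 4) (d * (d + 1) * (d + 2) / 3)) (fourCircuitBound d)) S * (min (5 * d) (p + d) - 4) + (d + 4).choose 5))) +
      (p + 4).choose 4 *
        (10584 * (min (min (d * (d + 1) / 2) ((d * d + 6 - 3 * d) / 2)) P * (p + d - 3) +
            min (min (min ((d + 3).choose 4) (d * (d + 1) * (d + 2) / 3)) (fourCircuitBound d)) S) +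
          (RSK 10 * (min (min (d * (d + 1) / 2) ((d * d + 6 - 3 * d) / 2)) P * (p + d - 3).choose 2 +
              min (min (min ((d + 3).choose 4) (d * (d + 1) * (d + 2) / 3)) (fourCircuitBound d)) S * (p + d - 4) + (d + 4).choose 5) +
            (RBK 10 - RSK 10) * (min (min (d * (d + 1) / 2) ((d * d + 6 - 3 * d) / 2)) P * (min (5 * d) (p + d) - 3).choose 2 +
              min (min (min ((d + 3).choose 4) (d * (d + 1) * (d + 2) / 3)) (fourCircuitBound d)) S * (min (5 * d) (p + d) - 4) + (d + 4).choose 5))) ≤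
      (p + 4).choose 4 * (7560 * ∑ j ∈ Finset.Ico 5 p, (p + d).choose j) := by
    unfold cellOK13 at hok
    simp only [CoreRegimes.chooseF_eq, UformF_eq] at hok
    exact of_decide_eq_true hok
  obtain ⟨hd78, hcell1, hcell2⟩ := hspec
  have hd4 : 4 ≤ d := by omega
  -- the counts and their caps
  set s3 := {C : Set α | M.IsCircuit C ∧ C.ncard = 3}.ncard with hs3
  set s4 := {C : Set α | M.IsCircuit C ∧ C.ncard = 4}.ncard with hs4
  set s5 := {C : Set α | M.IsCircuit C ∧ C.ncard = 5}.ncard with hs5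
  have hb3 : s3 ≤ min (min (d * (d + 1) / 2) ((d * d + 6 - 3 * d) / 2)) P := by
    have h := two_mul_ncard_triangles_le M (fun L hL hr => hline L hL hr.le) hd
    have h' : 2 * s3 ≤ d * (d + 1) := h
    have h2 := two_mul_ncard_triangles_add_three_mul_le_of_four_le M
      (fun L hL hr => hline L hL hr.le) hplane hd4 hd
    have h2' : 2 * s3 + 3 * d ≤ d * d + 6 := h2
    refine le_min (le_min ?_ ?_) hP
    · rw [Nat.le_div_iff_mul_le (by norm_num)]; omega
    · rw [Nat.le_div_iff_mul_le (by norm_num)]; omega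
  have hb4 : s4 ≤ min (min (min ((d + 3).choose 4) (d * (d + 1) * (d + 2) / 3)) (fourCircuitBound d)) S := by
    refine le_min (le_min (le_min (ncard_circuits_four_le M hd) ?_) (ncard_fourCircuits_le_fourCircuitBound M hfree hd)) hS
    have h := three_mul_ncard_four_circuits_le M hline hplane hd
    have h' : 3 * s4 ≤ d * (d + 1) * (d + 2) := h
    rw [Nat.le_div_iff_mul_le (by norm_num)]
    omega
  have hb5 : s5 ≤ (d + 4).choose 5 := ncard_circuits_five_le M hd
  set s3B := min (min (d * (d + 1) / 2) ((d * d + 6 - 3 * d) / 2)) P with hs3B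
  set s4B := min (min (min ((d + 3).choose 4) (d * (d + 1) * (d + 2) / 3)) (fourCircuitBound d)) S with hs4B
  -- the per-flat branch: the sub-case count
  have hUpf : 7560 * Matroid.topCount M p 4 ≤
      (if d = 7 then
        max (Uform p 7 (RB9 7) 0 12 s3B s4B ((d + 4).choose 5))
          (Uform p 7 (RM 7) (7560 * betaK 10 7) (min 35 (p + d)) s3B s4B ((d + 4).choose 5))
      else
        max (max (Uform p 8 (RB9 8) (7560 * betaK 10 8) 13 s3B s4B ((d + 4).choose 5))
            (Uform p 8 (RM 8) (7560 * betaK 10 8) (min 40 (p + d)) s3B s4B ((d + 4).choose 5)))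
          (Uform p 8 (RB9 8) 0 (min 40 (p + d)) s3B s4B ((d + 4).choose 5))) := by
    rcases hd78 with h7 | h8
    · rw [if_pos h7]
      subst h7
      exact count_sub7 M p hR hn hcirc hline hplane hten hd hp hb3 hb4 hb5
    · rw [if_neg (by omega)]
      subst h8
      exact count_sub8 M p hR hn hcirc hline hplane hten hd hp hb3 hb4 hb5
  -- the split branch and the `Y`-side, as in `rls_of_cellOK8`
  have hU1 := topCount_le_ncard_eRk_eq_four_ncard_le M hR hd
  have hU3 := ncard_eRk_eq_ncard_le_le_split_joint' M 4 10 6 (by norm_num) hcirc hten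
    (fun X hX hr => hplane X hX (by simpa using hr)) hd
  rw [sum_Icc_three_five' (fun k => {C : Set α | M.IsCircuit C ∧ C.ncard = k}.ncard),
    sum_Icc_three_five' (fun k => {C : Set α | M.IsCircuit C ∧ C.ncard = k}.ncard)] at hU3
  have hY := midCount_ge_K7 M hcirc hline hplane hten hd p
  rw [hn] at hU3 hY
  set m := min (5 * d) (p + d) with hm
  set piAll := s3 * (p + d - 3).choose 2 + s4 * (p + d - 4) + s5 with hpiAll
  set piS0 := s3 * (m - 3).choose 2 + s4 * (m - 4) + s5 with hpiS0
  set piAllB := s3B * (p + d - 3).choose 2 + s4B * (p + d - 4) + (d + 4).choose 5 with hpiAllB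
  set piS0B := s3B * (m - 3).choose 2 + s4B * (m - 4) + (d + 4).choose 5 with hpiS0B
  have hpiAll_le : piAll ≤ piAllB := by
    rw [hpiAll, hpiAllB]; gcongr
  have hpiS0_le : piS0 ≤ piS0B := by
    rw [hpiS0, hpiS0B]; gcongr
  set R34B := 10584 * (s3B * (p + d - 3) + s4B) + (RSK 10 * piAllB + (RBK 10 - RSK 10) * piS0B) with hR34B
  set sigs := ∑ j ∈ Finset.range (d - 5 + 1), Nat.choose 2 j with hsigs
  set sig := ∑ j ∈ Finset.range (d - 5 + 1), Nat.choose 5 j with hsig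
  set Ysum := 7560 * ∑ j ∈ Finset.Ico 5 p, (p + d).choose j with hYsum
  set phiNum := 2 ^ (p + 4) - 2 * ∑ u ∈ Finset.range 5, (p + 4).choose u with hphiNum
  set phiDen := (p + 4).choose 4 with hphiDen
  have hUsp : 7560 * Matroid.topCount M p 4 ≤ 7560 * ((p + d).choose 4 + sigs * piAllB + (sig - sigs) * piS0B) := by
    calc 7560 * Matroid.topCount M p 4
        ≤ 7560 * {B : Set α | B ⊆ M.E ∧ M.eRk B = 4 ∧ B.ncard ≤ d}.ncard := Nat.mul_le_mul_left _ hU1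
      _ ≤ 7560 * ((p + d).choose 4 + sigs * piAll + (sig - sigs) * piS0) := Nat.mul_le_mul_left _ hU3
      _ ≤ 7560 * ((p + d).choose 4 + sigs * piAllB + (sig - sigs) * piS0B) := by gcongr
  have hUB := le_min hUpf hUsp
  have hYB : Ysum ≤ 7560 * Matroid.midCount M p 4 + R34B := by
    calc Ysum ≤ 7560 * Matroid.midCount M p 4 + 10584 * (s3 * (p + d - 3) + s4) +
          (RSK 10 * piAll + (RBK 10 - RSK 10) * piS0) := hY
      _ ≤ 7560 * Matroid.midCount M p 4 + R34B := by
          rw [hR34B]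
          have h1 : 10584 * (s3 * (p + d - 3) + s4) ≤ 10584 * (s3B * (p + d - 3) + s4B) := by gcongr
          have : RSK 10 * piAll + (RBK 10 - RSK 10) * piS0 ≤ RSK 10 * piAllB + (RBK 10 - RSK 10) * piS0B := by
            gcongr
          omega
  have hchain : phiNum * (7560 * Matroid.topCount M p 4) ≤ phiDen * (7560 * Matroid.midCount M p 4) := by
    have h1 := Nat.mul_le_mul_left phiNum hUB
    have h2 : phiNum * _ + phiDen * R34B ≤ phiDen * Ysum := hcell2
    have h3 : phiDen * Ysum ≤ phiDen * (7560 * Matroid.midCount M p 4 + R34B) := Nat.mul_le_mul_left _ hYB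
    rw [Nat.mul_add] at h3
    omega
  -- cast to `ℚ`
  have hsum : 2 * ∑ u ∈ Finset.range 5, (p + 4).choose u ≤ 2 ^ (p + 4) := by
    have := sum_Ioo_choose_add_four p hp
    omega
  have hphiNumQ : (phiNum : ℚ) = 2 ^ (p + 4) - 2 * ∑ u ∈ Finset.range 5, ((p + 4).choose u : ℚ) := by
    rw [hphiNum, Nat.cast_sub hsum]
    push_cast
    ring
  have hΦ := phiK_four_mul_choose_eq p hp
  rw [← hphiNumQ] at hΦ
  have hDenPos : (0 : ℚ) < (phiDen : ℚ) := by
    rw [hphiDen]; exact_mod_cast Nat.choose_pos (by omega)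
  have hchainQ : (phiNum : ℚ) * (Matroid.topCount M p 4 : ℚ) ≤ (phiDen : ℚ) * (Matroid.midCount M p 4 : ℚ) := by
    have h : ((phiNum * (7560 * Matroid.topCount M p 4) : ℕ) : ℚ) ≤
        ((phiDen * (7560 * Matroid.midCount M p 4) : ℕ) : ℚ) := by exact_mod_cast hchain
    push_cast at h
    linarith
  rw [ThmN.RLS_iff]
  have hkey : phiK p 4 * (Matroid.topCount M p 4 : ℚ) * (phiDen : ℚ) ≤
      (Matroid.midCount M p 4 : ℚ) * (phiDen : ℚ) := by
    calc phiK p 4 * (Matroid.topCount M p 4 : ℚ) * (phiDen : ℚ)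
        = (phiK p 4 * (phiDen : ℚ)) * (Matroid.topCount M p 4 : ℚ) := by ring
      _ = (phiNum : ℚ) * (Matroid.topCount M p 4 : ℚ) := by rw [hphiDen, hΦ]
      _ ≤ (phiDen : ℚ) * (Matroid.midCount M p 4 : ℚ) := hchainQ
      _ = (Matroid.midCount M p 4 : ℚ) * (phiDen : ℚ) := by ring
  exact le_of_mul_le_mul_right hkey hDenPos


/-- **THE CELL `(11, 7)` MODULO `s₄ ≤ 73`**: an `e`-free core of rank `11` with `18` points and at most `73`
four-circuits satisfies `RLS` at level `4`. -/
theorem c025_core_eleven_seven_of_cap (M : Matroid α) [M.Finite] (hR : M.eRank = (11 : ℕ)) (hn : M.E.ncard = 18)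
    (hfree : ∀ e ∈ M.E, ∃ A ⊆ M.E \ {e}, e ∉ M.closure A ∧ e ∉ M.closure ((M.E \ {e}) \ A))
    (hS : {C : Set α | M.IsCircuit C ∧ C.ncard = 4}.ncard ≤ 73) : ThmN.RLS M 11 4 := by
  have hd : M.E.encard = M.eRank + ((7 : ℕ) : ℕ∞) := by
    rw [hR, ← M.ground_finite.cast_ncard_eq, hn]
    push_cast
    ring
  have hP : {C : Set α | M.IsCircuit C ∧ C.ncard = 3}.ncard ≤ 12 :=
    core_ncard_triangles_le_twelve_of_nullity_seven M hfree hd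
  exact rls_of_cellOK13 M 11 7 12 73 hR hn hfree hP hS (by norm_num) cell_eleven_seven_caps

/-- **THE CELL `(11, 8)` MODULO `s₄ ≤ 105`**. -/
theorem c025_core_eleven_eight_of_cap (M : Matroid α) [M.Finite] (hR : M.eRank = (11 : ℕ)) (hn : M.E.ncard = 19)
    (hfree : ∀ e ∈ M.E, ∃ A ⊆ M.E \ {e}, e ∉ M.closure A ∧ e ∉ M.closure ((M.E \ {e}) \ A))
    (hS : {C : Set α | M.IsCircuit C ∧ C.ncard = 4}.ncard ≤ 105) : ThmN.RLS M 11 4 := by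
  have hd : M.E.encard = M.eRank + ((8 : ℕ) : ℕ∞) := by
    rw [hR, ← M.ground_finite.cast_ncard_eq, hn]
    push_cast
    ring
  have hP : {C : Set α | M.IsCircuit C ∧ C.ncard = 3}.ncard ≤ 15 :=
    core_ncard_triangles_le_fifteen_of_nullity_eight M hfree hd
  exact rls_of_cellOK13 M 11 8 15 105 hR hn hfree hP hS (by norm_num) cell_eleven_eight_caps

/-- **THE CELL `(10, 11)` MODULO `s₄ ≤ 266`**. -/
theorem c025_core_ten_eleven_of_cap (M : Matroid α) [M.Finite] (hR : M.eRank = (10 : ℕ)) (hn : M.E.ncard = 21)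
    (hfree : ∀ e ∈ M.E, ∃ A ⊆ M.E \ {e}, e ∉ M.closure A ∧ e ∉ M.closure ((M.E \ {e}) \ A))
    (hS : {C : Set α | M.IsCircuit C ∧ C.ncard = 4}.ncard ≤ 266) : ThmN.RLS M 10 4 := by
  have hd : M.E.encard = M.eRank + ((11 : ℕ) : ℕ∞) := by
    rw [hR, ← M.ground_finite.cast_ncard_eq, hn]
    push_cast
    ring
  have hP : {C : Set α | M.IsCircuit C ∧ C.ncard = 3}.ncard ≤ 30 := by
    have h := core_ncard_triangles_le_cq M hfree hd
    rwa [show cq 11 = 30 by decide] at h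
  exact rls_of_cellOK10 M 10 11 30 266 (by norm_num) hR hn hfree hP hS (by norm_num) cell_ten_eleven_caps

end S1

end PercRepro
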